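import Summits.ResolutionOfSingularities.ResolutionOfSingularities.Theorems.FrobeniusLadderFInjectiveMacaulayficationE4FloorTwoCharts
import Summits.ResolutionOfSingularities.ResolutionOfSingularities.Theorems.FrobeniusLadderFInjectiveMacaulayficationE4GermPointBlowupFull
import Summits.ResolutionOfSingularities.ResolutionOfSingularities.Theorems.FrobeniusLadderFInjectiveMacaulayficationE4GermSingularCentre
import Summits.ResolutionOfSingularities.ResolutionOfSingularities.Theorems.FrobeniusLadderFInjectiveMacaulayficationStrictTransformChartN
import Summits.ResolutionOfSingularities.ResolutionOfSingularities.Theorems.FrobeniusLadderFInjectiveMacaulayficationTStepGerm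
import Summits.ResolutionOfSingularities.ResolutionOfSingularities.Theorems.WildQuotientsWildQuotientResolutionBlowupExitColonGlue
import Literature.AlgebraicGeometry.Resolution.NormalCrossingsLocal
import Literature.AlgebraicGeometry.Resolution.ArithmeticalThreefoldsBlowupFormProofs
import Literature.AlgebraicGeometry.Resolution.BlowupsFlatBaseChange
import Literature.AlgebraicGeometry.Resolution.BlowupsExistence
import Literature.AlgebraicGeometry.Resolution.AffineBlowupCartier
import Literature.AlgebraicGeometry.Resolution.AffineBlowupRegular
import HarnessLib

/-!
# E4″@G: (F2) part 2 + (F3) glue + (ROW) — the blowing up of `X₁ = Bl_𝔪 G` along the reduced singular locus `𝓚_E` IS REGULAR, and the T″(2,4,·)-instance row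
# `tStepInstanceAt_G_origin` (crux `FInjectiveMacaulayfication` stmt-ResolutionOfSingularities-15315, chain w45a; res-L1-w45a-plan-1 R19.1/R19.3; seat res-L1-w45a-stub-1 g11)

[OURS · L1 W4.5a] Support file (`--supports stmt-ResolutionOfSingularities-15315 --as helper`); replaces the role of NO printed item; NOT a statement of any
manuscript; def-free; UNCONDITIONAL. AI-written (AI review is weaker than expert review).

* §1 GENERIC GLUE. `comap_vanishingIdeal_eq_idealSheaf` — for an open immersion `ι : Spec A → X` and `Z = (Reg X)ᶜ`: `(vanishingIdeal Z)|_{Spec A} = J̃` as soon as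
  `J` is radical and `Sing(Spec A) = V(J)` ring-side; `isRegular_of_isBlowup_of_charts` — if `X` is covered by open immersions `ι_i : Spec A_i → X` with
  `𝓚|_{Spec A_i} = J̃_i` and every `Bl_{J_i} Spec A_i` regular, then EVERY blowing up of `X` along `𝓚` is a regular scheme (flat base change of blow-ups
  `IsBlowup.pullback_snd_of_flat`, uniqueness `IsBlowup.unique`, regularity through open immersions).
* §2 THE E4″ FLOOR 2. `X₁ = affineBlowup 𝔪`, `𝔪` the vertex of `G = {X₀X₁ + X₂³ + X₃³ + X₄³}` (char 2), `Z = (Reg X₁)ᶜ` (res-L1-w45a-lead-1's (F2) part 1 p629393),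
  charts `ι_i : Spec k[X]/(g_i) → X₁` (`StrictTransformChartN` + `affineBlowup.chartι`, res-L1-w45a-stub-2's strict transforms `g_i` of `E4GermPointBlowupFull.theta`):
  ★★ `isRegular_of_isBlowup_vanishingIdeal` — **every blowing up of `X₁` along `𝓚_E = vanishingIdeal Z` is a regular scheme** ((F2) part 2 = the five chart
  identifications `𝓚_E|_{D₊} = J̃_i` from `E4FloorTwoWChart` / `E4FloorTwoCharts`, (F3) = the glue).
* §3 ★★★ (ROW) `tStepInstanceAt_G_origin` — `TStepInstanceAt 2 v (𝔪̃·𝒪_{G,v})`: the FIRST T″(2,4,·)-INSTANCE IN THE KERNEL (one instance; evidence for nothing beyond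
  itself), via res-L1-w45a-stub-3's bridge `TStepGerm.tStepInstanceAt_of_isBlowup` with res-L1-w45a-lead-1's binders `E4GermSingularCentre.support_vanishingIdeal_over_vertex` /
  `comap_pullback_fst_vanishingIdeal_ne_bot`, existence of blowing ups, and §2.
[folklore; cite: GortzWedhorn2020, Prop. 13.91 (2), Prop. 13.92, (13.19); Liu2002, Thm. 8.1.19 (a); StacksProject, Tag 0804]
-/

-- single-problem summit: the doubled namespace component is forced
set_option linter.dupNamespace false

noncomputable section

namespace Summit.ResolutionOfSingularities.ResolutionOfSingularities.Theorems.FInjectiveMacaulayfication.E4FloorTwoGlue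

open MvPolynomial Literature.AlgebraicGeometry.Resolution AlgebraicGeometry CategoryTheory CategoryTheory.Limits TopologicalSpace
open Summit.ResolutionOfSingularities.ResolutionOfSingularities.Theorems.FInjectiveMacaulayfication
open Summit.ResolutionOfSingularities.ResolutionOfSingularities.Theorems.WildQuotientResolution (BlowupExit.affineBlowup.vanishingIdeal_zeroLocus)

/-! ## §1 Generic glue -/

/-- **`Bl_⊤(Spec A)` is regular for a regular ring `A`** (Liu 8.1.19 (a) in the tree's affine quasi-regular form at the sequence `(1)`; same statement as
`AffineToGlobal.Negative.isRegular_affineBlowup_top`, re-proved here to keep this file's imports inside the route's cone). [cite: Liu2002, Thm. 8.1.19 (a)] -/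
theorem isRegular_affineBlowup_top {A : Type} [CommRing A] [IsRegularRing A] : Scheme.IsRegular (affineBlowup (⊤ : Ideal A)) := by
  have htop : Ideal.span (Set.range ![(1 : A)]) = ⊤ := (Ideal.eq_top_iff_one _).mpr (Ideal.subset_span ⟨0, rfl⟩)
  have hq : IsQuasiRegular ![(1 : A)] := by
    intro n F _ _
    rw [htop, Ideal.map_top]
    trivial
  haveI : Subsingleton (A ⧸ Ideal.span (Set.range ![(1 : A)])) := Ideal.Quotient.subsingleton_iff.mpr htop
  haveI : IsRegularRing (A ⧸ Ideal.span (Set.range ![(1 : A)])) :=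
    { isRegularLocalRing_localization := fun p hp => (hp.ne_top (Subsingleton.elim p ⊤)).elim }
  have h := affineBlowup.isRegular_of_isQuasiRegular ![(1 : A)] hq
  rwa [htop] at h

/-- **The reduced singular locus restricted to an affine chart.** For an open immersion `ι : Spec A → X`, `Z = (Reg X)ᶜ` closed, and a radical ideal `J ⊆ A` with
`Sing(Spec A) = V(J)` (a prime `P` has `A_P` non-regular iff `P ⊇ J`): `(vanishingIdeal Z).comap ι = J̃` (`affineBlowup.idealSheaf J`). [folklore] -/
theorem comap_vanishingIdeal_eq_idealSheaf {X : Scheme.{0}} (Z : Closeds X) (hZ : (Z : Set X) = (Scheme.regularLocus X)ᶜ)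
    {A : Type} [CommRing A] (ι : Spec (.of A) ⟶ X) [IsOpenImmersion ι] (J : Ideal A) (hJ : J.radical = J)
    (hsing : ∀ (P : Ideal A) [P.IsPrime], ¬ IsRegularLocalRing (Localization.AtPrime P) ↔ J ≤ P) :
    (Scheme.IdealSheafData.vanishingIdeal Z).comap ι = affineBlowup.idealSheaf J := by
  rw [comap_vanishingIdeal_of_isOpenImmersion]
  have hpre : Z.preimage ι.continuous = ⟨PrimeSpectrum.zeroLocus (J : Set A), PrimeSpectrum.isClosed_zeroLocus _⟩ := by
    ext P
    change ι.base P ∈ (Z : Set X) ↔ P ∈ PrimeSpectrum.zeroLocus (J : Set A)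
    rw [hZ, Set.mem_compl_iff, ← mem_regularLocus_iff_of_flat_of_isPreimmersion ι P, regularLocus_Spec_eq, Set.mem_setOf_eq, hsing]
    exact ⟨fun h => (PrimeSpectrum.mem_zeroLocus _ _).mpr (SetLike.coe_subset_coe.mpr h),
      fun h => SetLike.coe_subset_coe.mp ((PrimeSpectrum.mem_zeroLocus _ _).mp h)⟩
  rw [hpre, BlowupExit.affineBlowup.vanishingIdeal_zeroLocus, hJ]

/-- ★ **GLUE: regularity of a blowing up from regular affine blow-up charts.** Let `π₂ : X₂ → X` be a blowing up along `𝓚`, and let `ι_i : Spec A_i → X` be open immersions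
covering `X` with `𝓚|_{Spec A_i} = J̃_i` and `Bl_{J_i} Spec A_i` regular for all `i`. Then `X₂` is regular: over `Spec A_i`, `π₂` pulls back (flat base change,
`IsBlowup.pullback_snd_of_flat`) to a blowing up along `J̃_i`, isomorphic to `Bl_{J_i} Spec A_i` (`IsBlowup.unique`), and the pull-backs cover `X₂` by open immersions.
[folklore; cite: GortzWedhorn2020, Prop. 13.91 (2), (13.19)] -/
theorem isRegular_of_isBlowup_of_charts {X X₂ : Scheme.{0}} (𝓚 : X.IdealSheafData) {π₂ : X₂ ⟶ X} (hπ₂ : IsBlowup π₂ 𝓚)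
    {ι₀ : Type} (A : ι₀ → Type) [∀ i, CommRing (A i)] (ι : ∀ i, Spec (.of (A i)) ⟶ X) [∀ i, IsOpenImmersion (ι i)]
    (hcov : ∀ x : X, ∃ i, x ∈ Set.range (ι i).base) (J : ∀ i, Ideal (A i)) (hID : ∀ i, 𝓚.comap (ι i) = affineBlowup.idealSheaf (J i))
    (hreg : ∀ i, Scheme.IsRegular (affineBlowup (J i))) : Scheme.IsRegular X₂ := by
  refine Scheme.IsRegular.of_forall_exists_isOpenImmersion fun x₂ => ?_
  obtain ⟨i, y, hy⟩ := hcov (π₂.base x₂)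
  -- the flat pull-back of `π₂` along `ι i` is a blowing up of `Spec A_i` along `J̃_i`
  have hP : IsBlowup (pullback.snd π₂ (ι i)) (affineBlowup.idealSheaf (J i)) := by
    rw [← hID i]; exact hπ₂.pullback_snd_of_flat (ι i)
  obtain ⟨e, -, -⟩ := hP.unique (affineBlowup.isBlowup (J i))
  -- `x₂` lies in the image of the pull-back
  have hx₂ : x₂ ∈ Set.range (pullback.fst π₂ (ι i)).base := by
    rw [Scheme.Pullback.range_fst]
    exact ⟨y, hy⟩
  obtain ⟨z, hz⟩ := hx₂
  refine ⟨affineBlowup (J i), e.inv ≫ pullback.fst π₂ (ι i), inferInstance, ⟨e.hom.base z, ?_⟩, hreg i⟩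
  rw [← hz, ← Scheme.Hom.comp_apply, ← Category.assoc, e.hom_inv_id, Category.id_comp]

/-! ## §2 The E4″ floor 2: every blowing up of `Bl_𝔪 G` along the reduced singular locus is regular -/

/-- `3 ≠ 0` in characteristic `2`. [plumbing] -/
theorem three_ne_zero_of_charP_two (k : Type) [Field k] [CharP k 2] : (3 : k) ≠ 0 := by
  have h2 : (2 : k) = 0 := by simpa using CharP.cast_eq_zero k 2
  rw [show (3 : k) = 2 + 1 by norm_num, h2, zero_add]
  exact one_ne_zero

/-- **Per-chart data ((F2) part 2 chartwise + the regular affine models).** For each of the five charts of `Bl_𝔪 G` (strict transforms `G i`, centres `CC i`: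
`(1,1,1,1)` on `D₊(a)`, `D₊(b)` — the unit ideal — and `(X₀, X₁, X_i, 1 + Σ X_j³)` on `D₊(wᵢ)`), and ANY open immersion `ι : Spec k[X]/(G i) → X₁`:
`(vanishingIdeal Z).comap ι = J̃_i` and `Bl_{J_i} Spec k[X]/(G i)` is a regular scheme. [folklore; cite: Liu2002, Thm. 8.1.19 (a)] -/
theorem chart_comap_and_isRegular (k : Type) [Field k] [CharP k 2] {X₁ : Scheme.{0}}
    (Z : Closeds ↥X₁) (hZ : (Z : Set ↥X₁) = (Scheme.regularLocus X₁)ᶜ)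
    (G : Fin 5 → MvPolynomial (Fin 5) k)
    (hG : G = ![X 1 + X 0 * (X 2 ^ 3 + X 3 ^ 3 + X 4 ^ 3), X 0 + X 1 * (X 2 ^ 3 + X 3 ^ 3 + X 4 ^ 3),
        X 0 * X 1 + X 2 * (1 + X 3 ^ 3 + X 4 ^ 3), X 0 * X 1 + X 3 * (1 + X 2 ^ 3 + X 4 ^ 3),
        X 0 * X 1 + X 4 * (1 + X 2 ^ 3 + X 3 ^ 3)])
    (CC : Fin 5 → Fin 4 → MvPolynomial (Fin 5) k)
    (hCC : CC = ![![1, 1, 1, 1], ![1, 1, 1, 1], ![X 0, X 1, X 2, 1 + X 3 ^ 3 + X 4 ^ 3], ![X 0, X 1, X 3, 1 + X 2 ^ 3 + X 4 ^ 3],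
        ![X 0, X 1, X 4, 1 + X 2 ^ 3 + X 3 ^ 3]])
    (i : Fin 5) : ∀ (ι : Spec (.of (MvPolynomial (Fin 5) k ⧸ Ideal.span {G i})) ⟶ X₁) [IsOpenImmersion ι],
    (Scheme.IdealSheafData.vanishingIdeal Z).comap ι =
        affineBlowup.idealSheaf ((Ideal.span (Set.range (CC i))).map (Ideal.Quotient.mk (Ideal.span {G i}))) ∧
      Scheme.IsRegular (affineBlowup ((Ideal.span (Set.range (CC i))).map (Ideal.Quotient.mk (Ideal.span {G i})))) := by
  have h3 := three_ne_zero_of_charP_two k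
  -- the two regular charts: centre = unit ideal
  have unit_chart : ∀ (g : MvPolynomial (Fin 5) k) (c : Fin 4 → MvPolynomial (Fin 5) k), c 0 = 1 → IsRegularRing (MvPolynomial (Fin 5) k ⧸ Ideal.span {g}) →
      ∀ (j : Spec (.of (MvPolynomial (Fin 5) k ⧸ Ideal.span {g})) ⟶ X₁) [IsOpenImmersion j],
      (Scheme.IdealSheafData.vanishingIdeal Z).comap j =
          affineBlowup.idealSheaf ((Ideal.span (Set.range c)).map (Ideal.Quotient.mk (Ideal.span {g}))) ∧
        Scheme.IsRegular (affineBlowup ((Ideal.span (Set.range c)).map (Ideal.Quotient.mk (Ideal.span {g})))) := by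
    intro g c hc hreg j _
    have htop : (Ideal.span (Set.range c)).map (Ideal.Quotient.mk (Ideal.span {g})) = ⊤ := by
      rw [Ideal.eq_top_iff_one, ← map_one (Ideal.Quotient.mk (Ideal.span {g}))]
      exact Ideal.mem_map_of_mem _ (Ideal.subset_span ⟨0, hc⟩)
    rw [htop]
    refine ⟨comap_vanishingIdeal_eq_idealSheaf Z hZ j ⊤ (Ideal.radical_top _) fun P hP => ?_, isRegular_affineBlowup_top⟩
    exact ⟨fun h => (h (IsRegularRing.isRegularLocalRing_localization P)).elim, fun h => (hP.ne_top (top_le_iff.mp h)).elim⟩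
  fin_cases i
  · intro ι hι
    exact @unit_chart (G 0) (CC 0) (by rw [hCC]; rfl) (E4FloorTwoCharts.isRegularRing_chartZero k (G 0) (by rw [hG]; rfl)) ι hι
  · intro ι hι
    exact @unit_chart (G 1) (CC 1) (by rw [hCC]; rfl) (E4FloorTwoCharts.isRegularRing_chartOne k (G 1) (by rw [hG]; rfl)) ι hι
  · intro ι hι
    have hG2 : G 2 = X 0 * X 1 + X 2 * (1 + X 3 ^ 3 + X 4 ^ 3) := by rw [hG]; rfl
    have hC2 : CC 2 = ![X 0, X 1, X 2, 1 + X 3 ^ 3 + X 4 ^ 3] := by rw [hCC]; rfl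
    exact ⟨@comap_vanishingIdeal_eq_idealSheaf _ Z hZ _ _ ι hι _ (E4FloorTwoCharts.isPrime_chartTwo k h3 (G 2) hG2 (CC 2) hC2 _ rfl).radical
        fun P hP => @E4FloorTwoWChart.not_isRegularLocalRing_iff_chartTwo k _ h3 (G 2) hG2 (CC 2) hC2 _ rfl P hP,
      E4FloorTwoWChart.isRegular_affineBlowup_chartTwo k h3 (G 2) hG2 (CC 2) hC2 _ rfl⟩
  · intro ι hι
    have hG3 : G 3 = X 0 * X 1 + X 3 * (1 + X 2 ^ 3 + X 4 ^ 3) := by rw [hG]; rfl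
    have hC3 : CC 3 = ![X 0, X 1, X 3, 1 + X 2 ^ 3 + X 4 ^ 3] := by rw [hCC]; rfl
    obtain ⟨-, hsing, hpr⟩ := E4FloorTwoCharts.chartThree k h3 (G 3) hG3 (CC 3) hC3 _ rfl
    exact ⟨@comap_vanishingIdeal_eq_idealSheaf _ Z hZ _ _ ι hι _ hpr.radical fun P hP => @hsing P hP,
      E4FloorTwoCharts.isRegular_affineBlowup_chartThree k h3 (G 3) hG3 (CC 3) hC3 _ rfl⟩
  · intro ι hι
    have hG4 : G 4 = X 0 * X 1 + X 4 * (1 + X 2 ^ 3 + X 3 ^ 3) := by rw [hG]; rfl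
    have hC4 : CC 4 = ![X 0, X 1, X 4, 1 + X 2 ^ 3 + X 3 ^ 3] := by rw [hCC]; rfl
    obtain ⟨-, hsing, hpr⟩ := E4FloorTwoCharts.chartFour k h3 (G 4) hG4 (CC 4) hC4 _ rfl
    exact ⟨@comap_vanishingIdeal_eq_idealSheaf _ Z hZ _ _ ι hι _ hpr.radical fun P hP => @hsing P hP,
      E4FloorTwoCharts.isRegular_affineBlowup_chartFour k h3 (G 4) hG4 (CC 4) hC4 _ rfl⟩

set_option maxHeartbeats 400000 in
/-- ★★ **(F2) part 2 + (F3): EVERY BLOWING UP OF `X₁ = Bl_𝔪 G` ALONG `𝓚_E = vanishingIdeal Z`, `Z = (Reg X₁)ᶜ`, IS A REGULAR SCHEME** (`G = {X₀X₁ + X₂³ + X₃³ + X₄³}`,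
char 2, any field). The five charts `ι_i : Spec k[X]/(g_i) → X₁` (`StrictTransformChartN.stub_strictTransformChartN` composed with `affineBlowup.chartι`) cover `X₁`; on
`D₊(a)`, `D₊(b)` the chart is regular so `𝓚_E| = ⊤̃` and `Bl_⊤` is regular; on `D₊(wᵢ)` `𝓚_E| = J̃_i` (`Sing = V(J_i)`, `J_i` prime) and `Bl_{J_i}` is regular
(`E4FloorTwoWChart`, `E4FloorTwoCharts`); glue by `isRegular_of_isBlowup_of_charts`. [folklore; cite: GortzWedhorn2020, Prop. 13.91 (2); Liu2002, Thm. 8.1.19 (a)] -/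
theorem isRegular_of_isBlowup_vanishingIdeal (k : Type) [Field k] [CharP k 2] (f : MvPolynomial (Fin 5) k)
    (hf : f = X 0 * X 1 + X 2 ^ 3 + X 3 ^ 3 + X 4 ^ 3)
    (𝔪 : Ideal (MvPolynomial (Fin 5) k ⧸ Ideal.span {f})) (h𝔪 : 𝔪 = Ideal.span (Set.range fun j : Fin 5 => Ideal.Quotient.mk (Ideal.span {f}) (X j)))
    (Z : Closeds ↥(affineBlowup 𝔪)) (hZ : (Z : Set ↥(affineBlowup 𝔪)) = (Scheme.regularLocus (affineBlowup 𝔪))ᶜ)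
    {X₂ : Scheme.{0}} (π₂ : X₂ ⟶ affineBlowup 𝔪) (hπ₂ : IsBlowup π₂ (Scheme.IdealSheafData.vanishingIdeal Z)) :
    Scheme.IsRegular X₂ := by
  subst h𝔪
  have hprime := E4GermSpecimen.prime_f k f hf
  haveI hfprime : (Ideal.span {f}).IsPrime := (Ideal.span_singleton_prime hprime.ne_zero).mpr hprime
  -- the five strict transforms and centres (res-L1-w45a-stub-2's table), kept opaque behind equations
  obtain ⟨G, hG⟩ : ∃ G : Fin 5 → MvPolynomial (Fin 5) k,
      G = ![X 1 + X 0 * (X 2 ^ 3 + X 3 ^ 3 + X 4 ^ 3), X 0 + X 1 * (X 2 ^ 3 + X 3 ^ 3 + X 4 ^ 3),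
        X 0 * X 1 + X 2 * (1 + X 3 ^ 3 + X 4 ^ 3), X 0 * X 1 + X 3 * (1 + X 2 ^ 3 + X 4 ^ 3),
        X 0 * X 1 + X 4 * (1 + X 2 ^ 3 + X 3 ^ 3)] := ⟨_, rfl⟩
  obtain ⟨CC, hCC⟩ : ∃ CC : Fin 5 → Fin 4 → MvPolynomial (Fin 5) k,
      CC = ![![1, 1, 1, 1], ![1, 1, 1, 1], ![X 0, X 1, X 2, 1 + X 3 ^ 3 + X 4 ^ 3], ![X 0, X 1, X 3, 1 + X 2 ^ 3 + X 4 ^ 3],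
        ![X 0, X 1, X 4, 1 + X 2 ^ 3 + X 3 ^ 3]] := ⟨_, rfl⟩
  have hθ : ∀ i : Fin 5, MvPolynomial.aeval (fun j : Fin 5 => if j = i then (X i : MvPolynomial (Fin 5) k) else X j * X i) f = X i ^ 2 * G i := by
    rw [hG]; exact E4GermPointBlowupFull.theta k f hf
  have hfX := E4GermPointBlowupFull.f_not_mem_span_X k f hf
  have hGX : ∀ i : Fin 5, G i ∉ Ideal.span {(X i : MvPolynomial (Fin 5) k)} := by
    rw [hG]; exact E4GermPointBlowupFull.g_not_mem_span_X k
  have hGprime : ∀ i : Fin 5, (Ideal.span {G i}).IsPrime := fun i =>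
    (PrimeTransfer.stub_primeTransfer k 5 i f (G i) 2 (hθ i) (hfX i) (hGX i)).mp hfprime
  have hXG : ∀ i : Fin 5, (X i : MvPolynomial (Fin 5) k) ∉ Ideal.span {G i} := fun i =>
    PrimeTransfer.X_not_mem_span_of_isPrime (hGprime i) (hGX i)
  -- the chart isomorphisms `k[X]/(g_i) ≅ (A[𝔪t])_{(x̄ᵢt)}` and the open immersions `ι_i`
  have he : ∀ i : Fin 5, ∃ e : (MvPolynomial (Fin 5) k ⧸ Ideal.span {G i}) ≃+*
      HomogeneousLocalization.Away (reesGrading (Ideal.span (Set.range fun j : Fin 5 => Ideal.Quotient.mk (Ideal.span {f}) (X j))))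
        (reesT (Ideal.Quotient.mk (Ideal.span {f}) (X i)) (Ideal.subset_span (Set.mem_range_self i))),
      e (Ideal.Quotient.mk (Ideal.span {G i}) (X i)) =
        reesChartBase (Ideal.Quotient.mk (Ideal.span {f}) (X i)) (Ideal.subset_span (Set.mem_range_self i)) (Ideal.Quotient.mk (Ideal.span {f}) (X i)) :=
    fun i => StrictTransformChartN.stub_strictTransformChartN k 5 f (G i) i 2 hfprime hprime.ne_zero (hGprime i) (hXG i) (hθ i) _ rfl
  choose e _ using he
  refine isRegular_of_isBlowup_of_charts (Scheme.IdealSheafData.vanishingIdeal Z) hπ₂ (fun i : Fin 5 => MvPolynomial (Fin 5) k ⧸ Ideal.span {G i})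
    (fun i => Spec.map (e i).symm.toCommRingCatIso.hom ≫
      affineBlowup.chartι (Ideal.Quotient.mk (Ideal.span {f}) (X i)) (Ideal.subset_span (Set.mem_range_self i)))
    (fun x₁ => ?_) (fun i => (Ideal.span (Set.range (CC i))).map (Ideal.Quotient.mk (Ideal.span {G i})))
    (fun i => (chart_comap_and_isRegular k Z hZ G hG CC hCC i _).1) (fun i => (chart_comap_and_isRegular k Z hZ G hG CC hCC i
      (Spec.map (e i).symm.toCommRingCatIso.hom ≫ affineBlowup.chartι (Ideal.Quotient.mk (Ideal.span {f}) (X i)) (Ideal.subset_span (Set.mem_range_self i)))).2)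
  -- (COV) the charts `D₊(x̄ᵢ t)` cover `X₁`
  have htop := affineBlowup.iSup_basicOpen_reesT_generators_eq_top (fun j : Fin 5 => Ideal.Quotient.mk (Ideal.span {f}) (X j))
  have hx : x₁ ∈ (⨆ i : Fin 5, Proj.basicOpen (reesGrading (Ideal.span (Set.range fun j : Fin 5 => Ideal.Quotient.mk (Ideal.span {f}) (X j))))
      (reesT (Ideal.Quotient.mk (Ideal.span {f}) (X i)) (Ideal.mem_span_range_self (f := fun j : Fin 5 => Ideal.Quotient.mk (Ideal.span {f}) (X j)) (x := i)))) := by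
    rw [htop]; trivial
  obtain ⟨i, hi⟩ := Opens.mem_iSup.mp hx
  rw [← affineBlowup.image_top_chartι] at hi
  obtain ⟨y, -, hy⟩ := hi
  obtain ⟨y', hy'⟩ := (Spec.map (e i).symm.toCommRingCatIso.hom).surjective y
  refine ⟨i, y', ?_⟩
  change (affineBlowup.chartι _ _).base ((Spec.map (e i).symm.toCommRingCatIso.hom).base y') = x₁
  rw [show (Spec.map (e i).symm.toCommRingCatIso.hom).base y' = y from hy']
  exact hy

/-! ## §3 (ROW) the T″(2,4,·)-instance `(G, 𝔪)` -/

/-- ★★★ **(ROW) `tStepInstanceAt_G_origin` — THE FIRST T″(2,4,·)-INSTANCE IN THE KERNEL.** For `G = Spec k[X₀..X₄]/(X₀X₁ + X₂³ + X₃³ + X₄³)` over ANY field `k` of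
characteristic `2` and its vertex `v`: `TStepInstanceAt 2 v (𝔪̃·𝒪_{G,v})` — for every blowing up `g : S′ → Spec 𝒪_{G,v}` along the (pulled-back) vertex ideal which is regular off
the closed fibre and FULL everywhere, there is a fibre-supported `𝓚 ≠ ⊥` on `S′` ALL of whose blowing ups are regular schemes. Centre of record: `𝓚_E` = the reduced singular locus
of `Bl_𝔪 G` (the smooth Fermat cubic curve `E` in the exceptional `ℙ³`); assembled from res-L1-w45a-lead-1's (F2) part 1 (`E4GermSingularCentre`, p629393), res-L1-w45a-stub-3's
bridge `TStepGerm.tStepInstanceAt_of_isBlowup` (p621847), existence of blowing ups, and §2. ONE instance; evidence for nothing beyond itself. [OURS; folklore assembly;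
cite: GortzWedhorn2020, Prop. 13.91 (2), Prop. 13.92; Liu2002, Thm. 8.1.19 (a)] -/
theorem tStepInstanceAt_G_origin (k : Type) [Field k] [CharP k 2] (f : MvPolynomial (Fin 5) k)
    (hf : f = X 0 * X 1 + X 2 ^ 3 + X 3 ^ 3 + X 4 ^ 3)
    (v : Spec (.of (MvPolynomial (Fin 5) k ⧸ Ideal.span {f})))
    (hv : v.asIdeal = Ideal.span (Set.range fun j : Fin 5 => Ideal.Quotient.mk (Ideal.span {f}) (X j)))
    (𝔪 : Ideal (MvPolynomial (Fin 5) k ⧸ Ideal.span {f})) (h𝔪 : 𝔪 = Ideal.span (Set.range fun j : Fin 5 => Ideal.Quotient.mk (Ideal.span {f}) (X j))) :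
    TStepGerm.TStepInstanceAt 2 v ((affineBlowup.idealSheaf 𝔪).comap ((Spec (.of (MvPolynomial (Fin 5) k ⧸ Ideal.span {f}))).fromSpecStalk v)) := by
  let Z : Closeds ↥(affineBlowup 𝔪) := ⟨(Scheme.regularLocus (affineBlowup 𝔪))ᶜ, E4GermSingularCentre.isClosed_compl_regularLocus k f 𝔪⟩
  have hZ : (Z : Set ↥(affineBlowup 𝔪)) = (Scheme.regularLocus (affineBlowup 𝔪))ᶜ := rfl
  obtain ⟨X₂, π₂, hπ₂⟩ := exists_isBlowup (affineBlowup 𝔪) (Scheme.IdealSheafData.vanishingIdeal Z)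
  have hreg := isRegular_of_isBlowup_vanishingIdeal k f hf 𝔪 h𝔪 Z hZ π₂ hπ₂
  exact TStepGerm.tStepInstanceAt_of_isBlowup 2 v (affineBlowup.isBlowup 𝔪) (Scheme.IdealSheafData.vanishingIdeal Z)
    (E4GermSingularCentre.comap_pullback_fst_vanishingIdeal_ne_bot k f hf v hv 𝔪 h𝔪 Z hZ)
    (E4GermSingularCentre.support_vanishingIdeal_over_vertex k f hf v hv 𝔪 h𝔪 Z hZ) hπ₂ fun x₂ _ => hreg x₂

end Summit.ResolutionOfSingularities.ResolutionOfSingularities.Theorems.FInjectiveMacaulayfication.E4FloorTwoGlue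

end
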